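/-
Copyright (c) 2026 the pub-hodgecm-mathlib formalisation cell (harness21).  Prover seat hodgecm-mathlib-LH3-p03 (g6): LH3 «Transf» road, letter L3′ surjective half,
brick (Σ4c-sec) (carve F0P3a-p04 (g25) 2026-09-02T12:57:32Z∕13:01:37Z; consumer LH10-p02 (g7) ★ (Σ4c-asm) `exists_classDescent_of_section_of_descent`; census LH10-p02 (g7)).
-/
import Literature.NumberTheory.Rogawski1990.ArchBouazizClassMap          -- ★ p851469 (LH10-p01 (g5)): `bzClassMap`, `bzClassMap_of_mem ∕ _of_not_mem ∕ _congr`; brings ★ `ArchCartanCoordinates` (`RegS`)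
import Mathlib.Analysis.SpecialFunctions.Complex.LogDeriv                -- `Complex.contDiffAt_log` on `slitPlane`
import Mathlib.Analysis.SpecialFunctions.Arcosh                          -- `Real.arcosh`, `cosh_arcosh`, `arcosh_cosh`, `contDiffAt_arcosh`, `arcosh_pos`
import Mathlib.Analysis.SpecialFunctions.Trigonometric.DerivHyp          -- `Real.one_lt_cosh`
import HarnessLib

/-!
# (Σ4c-sec) part 1 — PER-PLACE SMOOTH LOCAL SECTIONS OF THE STABLE-CLASS DATA, ON THE IMAGE (Bouaziz 1994 §2.3, §5.1; Rogawski 1990 §3.6, §8.2)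

Topic `NumberTheory/Rogawski1990`; namespace `Literature.NumberTheory.Rogawski1990`.  THEOREMS ONLY (no `def`, no instance, no notation, no axiom, no named fact, no `sorry`);
GROUP-FREE.  Cell `pub/hodgecm-mathlib`, crux H413 (`stmt-HodgeConjecture-24833`), line LH3 (closer stub `stub_N9`), letter L3′, SURJ road (binder LH10-p01 (g5)), organ (Σ-REG)
(F0P3a-p04 (g25)), interface (Σ4c) ★ p851524 `exists_classDescent_of_section_of_descent` (LH10-p02 (g7)); carve input (Σ4c-sec) = this file (per-place sections) + the sibling
`ArchBouazizClassMapSection.lean` (place-by-place assembly = the `hsec` binder).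
THE RESULTS **`exists_section_compactPlace`**, **`exists_section_splitPlace`**: the per-place class data `(e₀ + e₂, e₀e₂, e₁)` (compact place, `e_i = e^{i c_{w,i}}`) and
`((eˣ + e⁻ˣ)e^{iθ}, e^{2iθ}, e^{ic₁})` (split place, `x = c_{w,0}`, `θ = c_{w,2}`) admit, near the data of a REGULAR base point (`e₀ ≠ e₂` resp. `x ≠ 0`), a smooth
`τ : ℂ × ℂ × ℂ → (Fin 3 → ℝ)` on an open `V` with `τ(base) =` the base coordinates and, at every datum IN THE IMAGE, coordinates with the SAME data, again regular (the data map is not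
injective — Weyl moves, `2π` — so the section is asked on the image only).  EXPLICIT (no inverse-function theorem; LH10-p02 (g7)'s census, F0P3a-p04's formulas):
* COMPACT: `D = t² − 4d`, `D(base) = μ²`, `μ = e₀ − e₂ ≠ 0`; root branch `√D := μ · exp(log(D∕μ²)∕2)` on `{D∕μ² ∈ slitPlane}` (`Complex.contDiffAt_log`), simple roots `λ± = (t ± √D)∕2`
  (`λ₊(base) = e₀`, `λ₊ + λ₋ = t`, `λ₊λ₋ = d`, `λ₊ ≠ λ₋`); angles `c⁰ + Im log(λ± e^{−ic⁰})`; ON THE IMAGE the roots are the unit eigenvalues (Vieta) and `‖z‖ = 1 ⇒ e^{i Im log z} = z`.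
* SPLIT: angle `θ⁰ + Im log(d e^{−2iθ⁰})∕2` (`e^{2iθ(y)} = d`, so `e^{iθ(y)} = ±e^{iθ_c}` on the image), `ρ(y) = Re(t e^{−iθ(y)})∕2` with the open condition `ρ > 1` (`ρ(base) = cosh x > 1`)
  forcing the sign `+`, `x(y) = ±arcosh ρ(y)` with the sign of the base `x` (`cosh` even; `x(y) ≠ 0` by `arcosh_pos`).
HONEST LABEL: count-neutral; HC_CM is proved only modulo the 7 printed citations (2 remaining: hLiu418 = stmt-HodgeConjecture-24832, h413 = stmt-HodgeConjecture-24833) until rung 0 closes.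

## References
* [Bouaziz1994IntegralesOrbitales] A. Bouaziz, *Intégrales orbitales sur les groupes de Lie réductifs*, Ann. Sci. ÉNS (4) 27 (1994) 573–609: §2.3 p. 578, §5.1 p. 588 (functions of the stable class).
* [Rogawski1990] J. D. Rogawski, *Automorphic Representations of Unitary Groups in Three Variables*, Ann. of Math. Stud. 123 (1990), §3.6 p. 31 (stable classes in `U(2)`, `U(1,1)` by
  eigenvalue data), §8.2 p. 122 (the Cartan charts).
-/

set_option autoImplicit false

noncomputable section
open Complex Set Function Real Topology
open scoped ContDiff
open Literature.NumberTheory.Automorphic.ArchCartan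

namespace Literature.NumberTheory.Rogawski1990

/-! ## §1 Unit-circle and branch tools -/

/-- A unit complex number is recovered from the imaginary part of its logarithm: `e^{i·Im log z} = z` for `‖z‖ = 1`. [cite: Rogawski1990, §3.6 p. 31] -/
theorem coe_circleExp_log_im_of_norm_eq_one {z : ℂ} (hz : ‖z‖ = 1) : (Circle.exp (Complex.log z).im : ℂ) = z := by
  rw [Circle.coe_exp, Complex.log_im]
  have h := Complex.norm_mul_exp_arg_mul_I z
  rw [hz, Complex.ofReal_one, one_mul] at h
  exact_mod_cast h

/-- `e^{ia} · e^{i·Im log(z · e^{−ia})} = z` for a unit `z` (the angle of `z` read near the base angle `a`). [cite: Rogawski1990, §3.6 p. 31] -/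
theorem coe_circleExp_add_log_im {a : ℝ} {z : ℂ} (hz : ‖z‖ = 1) :
    (Circle.exp (a + (Complex.log (z * ((Circle.exp a : ℂ))⁻¹)).im) : ℂ) = z := by
  have hu : ‖z * ((Circle.exp a : ℂ))⁻¹‖ = 1 := by rw [norm_mul, norm_inv, Circle.norm_coe, hz, inv_one, mul_one]
  rw [Circle.exp_add, Circle.coe_mul, coe_circleExp_log_im_of_norm_eq_one hu]
  field_simp [Circle.coe_ne_zero (Circle.exp a)]

/-! ## §2 The compact place: a smooth local section of `(θ₀, θ₁, θ₂) ↦ (e₀ + e₂, e₀ e₂, e₁)` near a point with `e₀ ≠ e₂` -/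

/-- **LOCAL SECTION AT A COMPACT PLACE.**  Near the class data `(e₀ + e₂, e₀e₂, e₁)` of a point with `e₀ ≠ e₂` there is a smooth `τ` into the angle coordinates with
`τ(base) = (θ₀, θ₁, θ₂)` and, at every class datum OF A CHART POINT in the neighbourhood, `τ` returns angles with the SAME class data and with `e^{iτ₀} ≠ e^{iτ₂}`
(explicit: the simple-root branch `(t + μ·exp(log((t² − 4d)∕μ²)∕2))∕2`, `μ = e₀ − e₂`, and angle branches through `Complex.log` near `1`). [cite: Rogawski1990, §3.6 p. 31; §8.2 p. 122]
[cite: Bouaziz1994IntegralesOrbitales, §5.1 p. 588] -/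
theorem exists_section_compactPlace (v₀ : Fin 3 → ℝ) (h : Circle.exp (v₀ 0) ≠ Circle.exp (v₀ 2)) :
    ∃ V : Set (ℂ × ℂ × ℂ), IsOpen V ∧
      (((Circle.exp (v₀ 0) : ℂ) + Circle.exp (v₀ 2), (Circle.exp (v₀ 0) : ℂ) * Circle.exp (v₀ 2), (Circle.exp (v₀ 1) : ℂ)) : ℂ × ℂ × ℂ) ∈ V ∧
      ∃ τ : ℂ × ℂ × ℂ → (Fin 3 → ℝ), ContDiffOn ℝ ∞ τ V ∧
        τ ((Circle.exp (v₀ 0) : ℂ) + Circle.exp (v₀ 2), (Circle.exp (v₀ 0) : ℂ) * Circle.exp (v₀ 2), (Circle.exp (v₀ 1) : ℂ)) = v₀ ∧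
        ∀ v : Fin 3 → ℝ, (((Circle.exp (v 0) : ℂ) + Circle.exp (v 2), (Circle.exp (v 0) : ℂ) * Circle.exp (v 2), (Circle.exp (v 1) : ℂ)) : ℂ × ℂ × ℂ) ∈ V →
          (((Circle.exp (τ ((Circle.exp (v 0) : ℂ) + Circle.exp (v 2), (Circle.exp (v 0) : ℂ) * Circle.exp (v 2), (Circle.exp (v 1) : ℂ)) 0) : ℂ) +
              Circle.exp (τ ((Circle.exp (v 0) : ℂ) + Circle.exp (v 2), (Circle.exp (v 0) : ℂ) * Circle.exp (v 2), (Circle.exp (v 1) : ℂ)) 2),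
            (Circle.exp (τ ((Circle.exp (v 0) : ℂ) + Circle.exp (v 2), (Circle.exp (v 0) : ℂ) * Circle.exp (v 2), (Circle.exp (v 1) : ℂ)) 0) : ℂ) *
              Circle.exp (τ ((Circle.exp (v 0) : ℂ) + Circle.exp (v 2), (Circle.exp (v 0) : ℂ) * Circle.exp (v 2), (Circle.exp (v 1) : ℂ)) 2),
            (Circle.exp (τ ((Circle.exp (v 0) : ℂ) + Circle.exp (v 2), (Circle.exp (v 0) : ℂ) * Circle.exp (v 2), (Circle.exp (v 1) : ℂ)) 1) : ℂ)) : ℂ × ℂ × ℂ) =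
            ((Circle.exp (v 0) : ℂ) + Circle.exp (v 2), (Circle.exp (v 0) : ℂ) * Circle.exp (v 2), (Circle.exp (v 1) : ℂ)) ∧
          Circle.exp (τ ((Circle.exp (v 0) : ℂ) + Circle.exp (v 2), (Circle.exp (v 0) : ℂ) * Circle.exp (v 2), (Circle.exp (v 1) : ℂ)) 0) ≠
            Circle.exp (τ ((Circle.exp (v 0) : ℂ) + Circle.exp (v 2), (Circle.exp (v 0) : ℂ) * Circle.exp (v 2), (Circle.exp (v 1) : ℂ)) 2) := by
  -- the base eigenvalues and the discriminant root `μ = e₀ − e₂ ≠ 0`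
  set e₀ : ℂ := (Circle.exp (v₀ 0) : ℂ) with he₀
  set e₂ : ℂ := (Circle.exp (v₀ 2) : ℂ) with he₂
  set e₁ : ℂ := (Circle.exp (v₀ 1) : ℂ) with he₁
  have hμ : e₀ - e₂ ≠ 0 := by
    rw [sub_ne_zero]; intro hh; exact h (Circle.ext hh)
  have hμ2 : (e₀ - e₂) ^ 2 ≠ 0 := pow_ne_zero 2 hμ
  have he₀0 : e₀ ≠ 0 := Circle.coe_ne_zero _
  have he₂0 : e₂ ≠ 0 := Circle.coe_ne_zero _
  have he₁0 : e₁ ≠ 0 := Circle.coe_ne_zero _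
  -- the explicit maps
  let Dq : ℂ × ℂ × ℂ → ℂ := fun Y => (Y.1 ^ 2 - 4 * Y.2.1) / (e₀ - e₂) ^ 2
  let rt : ℂ × ℂ × ℂ → ℂ := fun Y => (e₀ - e₂) * Complex.exp (Complex.log (Dq Y) / 2)
  let lp : ℂ × ℂ × ℂ → ℂ := fun Y => (Y.1 + rt Y) / 2
  let lm : ℂ × ℂ × ℂ → ℂ := fun Y => (Y.1 - rt Y) / 2
  let τ : ℂ × ℂ × ℂ → (Fin 3 → ℝ) := fun Y =>
    ![v₀ 0 + (Complex.log (lp Y * e₀⁻¹)).im, v₀ 1 + (Complex.log (Y.2.2 * e₁⁻¹)).im, v₀ 2 + (Complex.log (lm Y * e₂⁻¹)).im]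
  -- the open set
  let V₁ : Set (ℂ × ℂ × ℂ) := Dq ⁻¹' slitPlane
  have hDqc : Continuous Dq := by
    refine Continuous.div_const ?_ _
    exact ((continuous_fst.pow 2).sub (continuous_const.mul (continuous_fst.comp continuous_snd)))
  have hV₁ : IsOpen V₁ := isOpen_slitPlane.preimage hDqc
  have hrtc : ContinuousOn rt V₁ := by
    refine continuousOn_const.mul ((Continuous.continuousOn Complex.continuous_exp).comp ?_ (mapsTo_univ _ _))
    exact ((hDqc.continuousOn).clog (fun Y hY => hY)).div_const _
  have hlpc : ContinuousOn lp V₁ := (continuous_fst.continuousOn.add hrtc).div_const _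
  have hlmc : ContinuousOn lm V₁ := (continuous_fst.continuousOn.sub hrtc).div_const _
  let V : Set (ℂ × ℂ × ℂ) := V₁ ∩ ((fun Y => lp Y * e₀⁻¹) ⁻¹' slitPlane) ∩ ((fun Y => lm Y * e₂⁻¹) ⁻¹' slitPlane) ∩ ((fun Y : ℂ × ℂ × ℂ => Y.2.2 * e₁⁻¹) ⁻¹' slitPlane)
  have hV : IsOpen V := by
    have h1 : IsOpen (V₁ ∩ ((fun Y => lp Y * e₀⁻¹) ⁻¹' slitPlane)) := (hlpc.mul continuousOn_const).isOpen_inter_preimage hV₁ isOpen_slitPlane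
    have h2 : IsOpen (V₁ ∩ ((fun Y => lp Y * e₀⁻¹) ⁻¹' slitPlane) ∩ ((fun Y => lm Y * e₂⁻¹) ⁻¹' slitPlane)) :=
      ((hlmc.mul continuousOn_const).mono inter_subset_left).isOpen_inter_preimage h1 isOpen_slitPlane
    exact h2.inter (isOpen_slitPlane.preimage ((continuous_snd.comp continuous_snd).mul continuous_const))
  -- the base point
  have hD0 : Dq (e₀ + e₂, e₀ * e₂, e₁) = 1 := by
    show ((e₀ + e₂) ^ 2 - 4 * (e₀ * e₂)) / (e₀ - e₂) ^ 2 = 1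
    rw [div_eq_one_iff_eq hμ2]; ring
  have hrt0 : rt (e₀ + e₂, e₀ * e₂, e₁) = e₀ - e₂ := by
    show (e₀ - e₂) * Complex.exp (Complex.log (Dq (e₀ + e₂, e₀ * e₂, e₁)) / 2) = e₀ - e₂
    rw [hD0, Complex.log_one, zero_div, Complex.exp_zero, mul_one]
  have hlp0 : lp (e₀ + e₂, e₀ * e₂, e₁) = e₀ := by
    show ((e₀ + e₂) + rt (e₀ + e₂, e₀ * e₂, e₁)) / 2 = e₀
    rw [hrt0]; ring
  have hlm0 : lm (e₀ + e₂, e₀ * e₂, e₁) = e₂ := by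
    show ((e₀ + e₂) - rt (e₀ + e₂, e₀ * e₂, e₁)) / 2 = e₂
    rw [hrt0]; ring
  have hmem0 : ((e₀ + e₂, e₀ * e₂, e₁) : ℂ × ℂ × ℂ) ∈ V := by
    refine ⟨⟨⟨?_, ?_⟩, ?_⟩, ?_⟩
    · show Dq (e₀ + e₂, e₀ * e₂, e₁) ∈ slitPlane
      rw [hD0]; exact one_mem_slitPlane
    · show lp (e₀ + e₂, e₀ * e₂, e₁) * e₀⁻¹ ∈ slitPlane
      rw [hlp0, mul_inv_cancel₀ he₀0]; exact one_mem_slitPlane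
    · show lm (e₀ + e₂, e₀ * e₂, e₁) * e₂⁻¹ ∈ slitPlane
      rw [hlm0, mul_inv_cancel₀ he₂0]; exact one_mem_slitPlane
    · show e₁ * e₁⁻¹ ∈ slitPlane
      rw [mul_inv_cancel₀ he₁0]; exact one_mem_slitPlane
  refine ⟨V, hV, hmem0, τ, ?_, ?_, ?_⟩
  · -- smoothness on `V`
    have hDs : ContDiff ℝ ∞ Dq := by
      refine ContDiff.div_const ?_ _
      exact (contDiff_fst.pow 2).sub (contDiff_const.mul (contDiff_fst.comp contDiff_snd))
    have hlogD : ContDiffOn ℝ ∞ (fun Y => Complex.log (Dq Y)) V := by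
      intro Y hY
      exact ((Complex.contDiffAt_log (hY.1.1.1)).restrict_scalars ℝ).comp_contDiffWithinAt Y (hDs.contDiffAt.contDiffWithinAt)
    have hrts : ContDiffOn ℝ ∞ rt V :=
      contDiffOn_const.mul ((Complex.contDiff_exp (𝕜 := ℝ)).comp_contDiffOn (hlogD.div_const _))
    have hlps : ContDiffOn ℝ ∞ lp V := (contDiff_fst.contDiffOn.add hrts).div_const _
    have hlms : ContDiffOn ℝ ∞ lm V := (contDiff_fst.contDiffOn.sub hrts).div_const _
    have hL0 : ContDiffOn ℝ ∞ (fun Y => (Complex.log (lp Y * e₀⁻¹)).im) V := by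
      intro Y hY
      have h1 : ContDiffWithinAt ℝ ∞ (fun Y => lp Y * e₀⁻¹) V Y := (hlps Y hY).mul contDiffWithinAt_const
      exact (Complex.imCLM.contDiff.contDiffAt).comp_contDiffWithinAt Y
        ((((Complex.contDiffAt_log hY.1.1.2).restrict_scalars ℝ)).comp_contDiffWithinAt Y h1)
    have hL2 : ContDiffOn ℝ ∞ (fun Y => (Complex.log (lm Y * e₂⁻¹)).im) V := by
      intro Y hY
      have h1 : ContDiffWithinAt ℝ ∞ (fun Y => lm Y * e₂⁻¹) V Y := (hlms Y hY).mul contDiffWithinAt_const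
      exact (Complex.imCLM.contDiff.contDiffAt).comp_contDiffWithinAt Y
        ((((Complex.contDiffAt_log hY.1.2).restrict_scalars ℝ)).comp_contDiffWithinAt Y h1)
    have hL1 : ContDiffOn ℝ ∞ (fun Y : ℂ × ℂ × ℂ => (Complex.log (Y.2.2 * e₁⁻¹)).im) V := by
      intro Y hY
      have h1 : ContDiffWithinAt ℝ ∞ (fun Y : ℂ × ℂ × ℂ => Y.2.2 * e₁⁻¹) V Y := (contDiff_snd.comp contDiff_snd).contDiffAt.contDiffWithinAt.mul contDiffWithinAt_const
      exact (Complex.imCLM.contDiff.contDiffAt).comp_contDiffWithinAt Y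
        ((((Complex.contDiffAt_log hY.2).restrict_scalars ℝ)).comp_contDiffWithinAt Y h1)
    rw [contDiffOn_pi]
    intro i
    fin_cases i
    · exact contDiffOn_const.add hL0
    · exact contDiffOn_const.add hL1
    · exact contDiffOn_const.add hL2
  · -- the base value
    funext i
    fin_cases i
    · show v₀ 0 + (Complex.log (lp (e₀ + e₂, e₀ * e₂, e₁) * e₀⁻¹)).im = v₀ 0
      rw [hlp0, mul_inv_cancel₀ he₀0, Complex.log_one, Complex.zero_im, add_zero]
    · show v₀ 1 + (Complex.log (e₁ * e₁⁻¹)).im = v₀ 1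
      rw [mul_inv_cancel₀ he₁0, Complex.log_one, Complex.zero_im, add_zero]
    · show v₀ 2 + (Complex.log (lm (e₀ + e₂, e₀ * e₂, e₁) * e₂⁻¹)).im = v₀ 2
      rw [hlm0, mul_inv_cancel₀ he₂0, Complex.log_one, Complex.zero_im, add_zero]
  · -- the section identity on the image and the non-degeneracy
    intro v hv
    set f₀ : ℂ := (Circle.exp (v 0) : ℂ) with hf₀
    set f₂ : ℂ := (Circle.exp (v 2) : ℂ) with hf₂
    set f₁ : ℂ := (Circle.exp (v 1) : ℂ) with hf₁
    set Y : ℂ × ℂ × ℂ := (f₀ + f₂, f₀ * f₂, f₁) with hYdef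
    -- `rt Y ^ 2 = D(Y)` and Vieta for `lp, lm`
    have hDY : Dq Y ∈ slitPlane := hv.1.1.1
    have hDne : Dq Y ≠ 0 := Complex.slitPlane_ne_zero hDY
    have hrt2 : rt Y ^ 2 = Y.1 ^ 2 - 4 * Y.2.1 := by
      show ((e₀ - e₂) * Complex.exp (Complex.log (Dq Y) / 2)) ^ 2 = Y.1 ^ 2 - 4 * Y.2.1
      rw [mul_pow, ← Complex.exp_nat_mul, show ((2 : ℕ) : ℂ) * (Complex.log (Dq Y) / 2) = Complex.log (Dq Y) by push_cast; ring, Complex.exp_log hDne]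
      show (e₀ - e₂) ^ 2 * ((Y.1 ^ 2 - 4 * Y.2.1) / (e₀ - e₂) ^ 2) = Y.1 ^ 2 - 4 * Y.2.1
      field_simp
    have hrtne : rt Y ≠ 0 := mul_ne_zero hμ (Complex.exp_ne_zero _)
    have hsum : lp Y + lm Y = f₀ + f₂ := by show (Y.1 + rt Y) / 2 + (Y.1 - rt Y) / 2 = f₀ + f₂; ring
    have hprod : lp Y * lm Y = f₀ * f₂ := by
      show (Y.1 + rt Y) / 2 * ((Y.1 - rt Y) / 2) = f₀ * f₂
      have : (Y.1 + rt Y) / 2 * ((Y.1 - rt Y) / 2) = (Y.1 ^ 2 - rt Y ^ 2) / 4 := by ring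
      rw [this, hrt2]; simp only [hYdef]; ring
    have hne : lp Y ≠ lm Y := by
      intro hh
      apply hrtne
      have : lp Y - lm Y = rt Y := by show (Y.1 + rt Y) / 2 - (Y.1 - rt Y) / 2 = rt Y; ring
      rw [← this, hh, sub_self]
    -- the roots are the two unit eigenvalues, in some order
    have hunit : ‖lp Y‖ = 1 ∧ ‖lm Y‖ = 1 := by
      have h0 : (lp Y - f₀) * (lp Y - f₂) = 0 := by linear_combination (lp Y) * hsum - hprod  -- hmm: uses lp*(lp+lm) - lp*lm = lp² + ... check below
      rcases mul_eq_zero.1 h0 with h1 | h1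
      · have ha : lp Y = f₀ := sub_eq_zero.1 h1
        have hb : lm Y = f₂ := by linear_combination hsum - ha
        rw [ha, hb]; exact ⟨Circle.norm_coe _, Circle.norm_coe _⟩
      · have ha : lp Y = f₂ := sub_eq_zero.1 h1
        have hb : lm Y = f₀ := by linear_combination hsum - ha
        rw [ha, hb]; exact ⟨Circle.norm_coe _, Circle.norm_coe _⟩
    have hτ0 : (Circle.exp (τ Y 0) : ℂ) = lp Y := by
      show (Circle.exp (v₀ 0 + (Complex.log (lp Y * e₀⁻¹)).im) : ℂ) = lp Y
      exact coe_circleExp_add_log_im hunit.1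
    have hτ2 : (Circle.exp (τ Y 2) : ℂ) = lm Y := by
      show (Circle.exp (v₀ 2 + (Complex.log (lm Y * e₂⁻¹)).im) : ℂ) = lm Y
      exact coe_circleExp_add_log_im hunit.2
    have hτ1 : (Circle.exp (τ Y 1) : ℂ) = f₁ := by
      show (Circle.exp (v₀ 1 + (Complex.log (Y.2.2 * e₁⁻¹)).im) : ℂ) = f₁
      exact coe_circleExp_add_log_im (Circle.norm_coe _)
    refine ⟨?_, ?_⟩
    · rw [hτ0, hτ2, hτ1, hsum, hprod]
    · intro hh
      apply hne
      have := congrArg (fun u : Circle => (u : ℂ)) hh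
      simpa only [hτ0, hτ2] using this

/-! ## §3 The split place: a smooth local section of `(x, c₁, θ) ↦ ((eˣ + e⁻ˣ)e^{iθ}, e^{2iθ}, e^{ic₁})` near a point with `x ≠ 0` -/

/-- `(e^{i(θ + s∕2)})² = e^{2iθ} · e^{is}`. [folklore] -/
private theorem coe_circleExp_add_half_sq (θ s : ℝ) : ((Circle.exp (θ + s / 2) : ℂ)) ^ 2 = (Circle.exp θ : ℂ) ^ 2 * (Circle.exp s : ℂ) := by
  rw [sq, ← Circle.coe_mul, ← Circle.exp_add, sq, ← Circle.coe_mul, ← Circle.exp_add, ← Circle.coe_mul, ← Circle.exp_add]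
  congr 2; ring

/-- **LOCAL SECTION AT A SPLIT PLACE.**  Near the class data `((eˣ + e⁻ˣ)e^{iθ}, e^{2iθ}, e^{ic₁})` of a point with `x ≠ 0` there is a smooth `τ` into the coordinates `(x, c₁, θ)` with
`τ(base) = (x, c₁, θ)` and, at every class datum of a chart point in the neighbourhood, `τ` returns coordinates with the SAME class data and with `x ≠ 0` (explicit: the angle
`θ + Im log(d e^{−2iθ})∕2`, then `x = ±arcosh(Re(t e^{−iθ(Y)})∕2)` on `{Re(t e^{−iθ(Y)})∕2 > 1}`, which forces the sign of `e^{iθ(Y)}`; `cosh` is even, so `±` is immaterial for the class).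
[cite: Rogawski1990, §3.6 p. 31] [cite: Bouaziz1994IntegralesOrbitales, §5.1 p. 588] -/
theorem exists_section_splitPlace (v₀ : Fin 3 → ℝ) (h : v₀ 0 ≠ 0) :
    ∃ V : Set (ℂ × ℂ × ℂ), IsOpen V ∧
      (((((Real.exp (v₀ 0) + Real.exp (-(v₀ 0)) : ℝ) : ℂ)) * (Circle.exp (v₀ 2) : ℂ), (Circle.exp (v₀ 2) : ℂ) ^ 2, (Circle.exp (v₀ 1) : ℂ)) : ℂ × ℂ × ℂ) ∈ V ∧
      ∃ τ : ℂ × ℂ × ℂ → (Fin 3 → ℝ), ContDiffOn ℝ ∞ τ V ∧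
        τ ((((Real.exp (v₀ 0) + Real.exp (-(v₀ 0)) : ℝ) : ℂ)) * (Circle.exp (v₀ 2) : ℂ), (Circle.exp (v₀ 2) : ℂ) ^ 2, (Circle.exp (v₀ 1) : ℂ)) = v₀ ∧
        ∀ v : Fin 3 → ℝ, (((((Real.exp (v 0) + Real.exp (-(v 0)) : ℝ) : ℂ)) * (Circle.exp (v 2) : ℂ), (Circle.exp (v 2) : ℂ) ^ 2, (Circle.exp (v 1) : ℂ)) : ℂ × ℂ × ℂ) ∈ V →
          (((((Real.exp (τ ((((Real.exp (v 0) + Real.exp (-(v 0)) : ℝ) : ℂ)) * (Circle.exp (v 2) : ℂ), (Circle.exp (v 2) : ℂ) ^ 2, (Circle.exp (v 1) : ℂ)) 0) +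
                Real.exp (-(τ ((((Real.exp (v 0) + Real.exp (-(v 0)) : ℝ) : ℂ)) * (Circle.exp (v 2) : ℂ), (Circle.exp (v 2) : ℂ) ^ 2, (Circle.exp (v 1) : ℂ)) 0)) : ℝ) : ℂ)) *
              (Circle.exp (τ ((((Real.exp (v 0) + Real.exp (-(v 0)) : ℝ) : ℂ)) * (Circle.exp (v 2) : ℂ), (Circle.exp (v 2) : ℂ) ^ 2, (Circle.exp (v 1) : ℂ)) 2) : ℂ),
            (Circle.exp (τ ((((Real.exp (v 0) + Real.exp (-(v 0)) : ℝ) : ℂ)) * (Circle.exp (v 2) : ℂ), (Circle.exp (v 2) : ℂ) ^ 2, (Circle.exp (v 1) : ℂ)) 2) : ℂ) ^ 2,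
            (Circle.exp (τ ((((Real.exp (v 0) + Real.exp (-(v 0)) : ℝ) : ℂ)) * (Circle.exp (v 2) : ℂ), (Circle.exp (v 2) : ℂ) ^ 2, (Circle.exp (v 1) : ℂ)) 1) : ℂ)) : ℂ × ℂ × ℂ) =
            ((((Real.exp (v 0) + Real.exp (-(v 0)) : ℝ) : ℂ)) * (Circle.exp (v 2) : ℂ), (Circle.exp (v 2) : ℂ) ^ 2, (Circle.exp (v 1) : ℂ)) ∧
          τ ((((Real.exp (v 0) + Real.exp (-(v 0)) : ℝ) : ℂ)) * (Circle.exp (v 2) : ℂ), (Circle.exp (v 2) : ℂ) ^ 2, (Circle.exp (v 1) : ℂ)) 0 ≠ 0 := by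
  set e : ℂ := (Circle.exp (v₀ 2) : ℂ) with he
  set e₁ : ℂ := (Circle.exp (v₀ 1) : ℂ) with he₁
  have he0 : e ≠ 0 := Circle.coe_ne_zero _
  have he2 : e ^ 2 ≠ 0 := pow_ne_zero 2 he0
  have he₁0 : e₁ ≠ 0 := Circle.coe_ne_zero _
  -- the explicit maps
  let θf : ℂ × ℂ × ℂ → ℝ := fun Y => v₀ 2 + (Complex.log (Y.2.1 * (e ^ 2)⁻¹)).im / 2
  let ρ : ℂ × ℂ × ℂ → ℝ := fun Y => (Y.1 * Complex.exp (-(θf Y : ℂ) * I)).re / 2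
  let xf : ℂ × ℂ × ℂ → ℝ := fun Y => if 0 ≤ v₀ 0 then Real.arcosh (ρ Y) else -Real.arcosh (ρ Y)
  let mf : ℂ × ℂ × ℂ → ℝ := fun Y => v₀ 1 + (Complex.log (Y.2.2 * e₁⁻¹)).im
  let τ : ℂ × ℂ × ℂ → (Fin 3 → ℝ) := fun Y => ![xf Y, mf Y, θf Y]
  -- the open set
  let V₁ : Set (ℂ × ℂ × ℂ) := (fun Y : ℂ × ℂ × ℂ => Y.2.1 * (e ^ 2)⁻¹) ⁻¹' slitPlane
  have hV₁ : IsOpen V₁ := isOpen_slitPlane.preimage ((continuous_fst.comp continuous_snd).mul continuous_const)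
  have hθc : ContinuousOn θf V₁ := by
    refine continuousOn_const.add (ContinuousOn.div_const ?_ _)
    exact Complex.continuous_im.comp_continuousOn ((((continuous_fst.comp continuous_snd).mul continuous_const).continuousOn).clog (fun Y hY => hY))
  have hρc : ContinuousOn ρ V₁ := by
    refine ContinuousOn.div_const (Complex.continuous_re.comp_continuousOn (continuous_fst.continuousOn.mul ?_)) _
    exact Complex.continuous_exp.comp_continuousOn (((Complex.continuous_ofReal.comp_continuousOn hθc).neg).mul continuousOn_const)
  let V : Set (ℂ × ℂ × ℂ) := (V₁ ∩ ρ ⁻¹' Ioi 1) ∩ ((fun Y : ℂ × ℂ × ℂ => Y.2.2 * e₁⁻¹) ⁻¹' slitPlane)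
  have hV : IsOpen V := (hρc.isOpen_inter_preimage hV₁ isOpen_Ioi).inter (isOpen_slitPlane.preimage ((continuous_snd.comp continuous_snd).mul continuous_const))
  -- the base point
  set Y₀ : ℂ × ℂ × ℂ := ((((Real.exp (v₀ 0) + Real.exp (-(v₀ 0)) : ℝ) : ℂ)) * e, e ^ 2, e₁) with hY₀
  have hθ0 : θf Y₀ = v₀ 2 := by
    show v₀ 2 + (Complex.log (e ^ 2 * (e ^ 2)⁻¹)).im / 2 = v₀ 2
    rw [mul_inv_cancel₀ he2, Complex.log_one, Complex.zero_im, zero_div, add_zero]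
  have hee : e * Complex.exp (-(v₀ 2 : ℂ) * I) = 1 := by
    rw [he, Circle.coe_exp, ← Complex.exp_add]; convert Complex.exp_zero using 2; ring
  have hρ0 : ρ Y₀ = Real.cosh (v₀ 0) := by
    show ((((Real.exp (v₀ 0) + Real.exp (-(v₀ 0)) : ℝ) : ℂ) * e) * Complex.exp (-(θf Y₀ : ℂ) * I)).re / 2 = Real.cosh (v₀ 0)
    rw [hθ0, mul_assoc, hee, mul_one, Complex.ofReal_re, Real.cosh_eq]
  have hρ0' : 1 < ρ Y₀ := by rw [hρ0]; exact Real.one_lt_cosh.2 h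
  have hmem0 : Y₀ ∈ V := by
    refine ⟨⟨?_, hρ0'⟩, ?_⟩
    · show e ^ 2 * (e ^ 2)⁻¹ ∈ slitPlane
      rw [mul_inv_cancel₀ he2]; exact one_mem_slitPlane
    · show e₁ * e₁⁻¹ ∈ slitPlane
      rw [mul_inv_cancel₀ he₁0]; exact one_mem_slitPlane
  have hx0 : xf Y₀ = v₀ 0 := by
    show (if 0 ≤ v₀ 0 then Real.arcosh (ρ Y₀) else -Real.arcosh (ρ Y₀)) = v₀ 0
    rw [hρ0]
    split_ifs with hs
    · exact Real.arcosh_cosh hs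
    · rw [← Real.cosh_neg, Real.arcosh_cosh (by linarith), neg_neg]
  refine ⟨V, hV, hmem0, τ, ?_, ?_, ?_⟩
  · -- smoothness on `V`
    have hθs : ContDiffOn ℝ ∞ θf V := by
      intro Y hY
      have h1 : ContDiffWithinAt ℝ ∞ (fun Y : ℂ × ℂ × ℂ => Y.2.1 * (e ^ 2)⁻¹) V Y := (contDiff_fst.comp contDiff_snd).contDiffAt.contDiffWithinAt.mul contDiffWithinAt_const
      exact contDiffWithinAt_const.add ((((Complex.imCLM.contDiff.contDiffAt).comp_contDiffWithinAt Y
        (((Complex.contDiffAt_log hY.1.1).restrict_scalars ℝ).comp_contDiffWithinAt Y h1))).div_const _)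
    have hρs : ContDiffOn ℝ ∞ ρ V := by
      refine ContDiffOn.div_const (Complex.reCLM.contDiff.comp_contDiffOn (contDiff_fst.contDiffOn.mul ?_)) _
      exact (Complex.contDiff_exp (𝕜 := ℝ)).comp_contDiffOn (((Complex.ofRealCLM.contDiff.comp_contDiffOn hθs).neg).mul contDiffOn_const)
    have hxs : ContDiffOn ℝ ∞ xf V := by
      have ha : ContDiffOn ℝ ∞ (fun Y => Real.arcosh (ρ Y)) V := fun Y hY => (Real.contDiffAt_arcosh hY.1.2).comp_contDiffWithinAt Y (hρs Y hY)
      by_cases hs : 0 ≤ v₀ 0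
      · exact ha.congr fun Y _ => by simp only [xf, hs, if_true]
      · exact ha.neg.congr fun Y _ => by simp only [xf, hs, if_false]
    have hL1 : ContDiffOn ℝ ∞ (fun Y : ℂ × ℂ × ℂ => (Complex.log (Y.2.2 * e₁⁻¹)).im) V := by
      intro Y hY
      have hY' : Y.2.2 * e₁⁻¹ ∈ slitPlane := hY.2
      have h1 : ContDiffWithinAt ℝ ∞ (fun Y : ℂ × ℂ × ℂ => Y.2.2 * e₁⁻¹) V Y := (contDiff_snd.comp contDiff_snd).contDiffAt.contDiffWithinAt.mul contDiffWithinAt_const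
      exact (Complex.imCLM.contDiff.contDiffAt).comp_contDiffWithinAt Y
        ((((Complex.contDiffAt_log hY').restrict_scalars ℝ)).comp_contDiffWithinAt Y h1)
    have hms : ContDiffOn ℝ ∞ mf V := contDiffOn_const.add hL1
    rw [contDiffOn_pi]
    intro i
    fin_cases i
    · exact hxs
    · exact hms
    · exact hθs
  · -- the base value
    funext i
    fin_cases i
    · exact hx0
    · show v₀ 1 + (Complex.log (e₁ * e₁⁻¹)).im = v₀ 1
      rw [mul_inv_cancel₀ he₁0, Complex.log_one, Complex.zero_im, add_zero]
    · exact hθ0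
  · -- the section identity on the image and `x ≠ 0`
    intro v hv
    set e' : ℂ := (Circle.exp (v 2) : ℂ) with he'
    set f₁ : ℂ := (Circle.exp (v 1) : ℂ) with hf₁
    set Y : ℂ × ℂ × ℂ := ((((Real.exp (v 0) + Real.exp (-(v 0)) : ℝ) : ℂ)) * e', e' ^ 2, f₁) with hYdef
    have he'0 : e' ≠ 0 := Circle.coe_ne_zero _
    -- the angle: `ξ² = e'²`
    have hunit : ‖e' ^ 2 * (e ^ 2)⁻¹‖ = 1 := by rw [norm_mul, norm_inv, norm_pow, norm_pow, Circle.norm_coe, Circle.norm_coe]; norm_num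
    have hξ2 : ((Circle.exp (θf Y) : ℂ)) ^ 2 = e' ^ 2 := by
      show ((Circle.exp (v₀ 2 + (Complex.log (Y.2.1 * (e ^ 2)⁻¹)).im / 2) : ℂ)) ^ 2 = e' ^ 2
      rw [coe_circleExp_add_half_sq, coe_circleExp_log_im_of_norm_eq_one hunit]
      show e ^ 2 * (Y.2.1 * (e ^ 2)⁻¹) = e' ^ 2
      simp only [hYdef]; field_simp
    have hξ : (Circle.exp (θf Y) : ℂ) = e' ∨ (Circle.exp (θf Y) : ℂ) = -e' := by
      have h0 : ((Circle.exp (θf Y) : ℂ) - e') * ((Circle.exp (θf Y) : ℂ) + e') = 0 := by linear_combination hξ2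
      rcases mul_eq_zero.1 h0 with h1 | h1
      · exact Or.inl (sub_eq_zero.1 h1)
      · exact Or.inr (eq_neg_of_add_eq_zero_left h1)
    have hinv : Complex.exp (-(θf Y : ℂ) * I) = ((Circle.exp (θf Y) : ℂ))⁻¹ := by
      rw [Circle.coe_exp, ← Complex.exp_neg]; congr 1; ring
    have hpos : 0 < Real.exp (v 0) + Real.exp (-(v 0)) := add_pos (Real.exp_pos _) (Real.exp_pos _)
    -- the sign is forced by `ρ > 1`
    have hρY : 1 < ρ Y := hv.1.2
    have hξe : (Circle.exp (θf Y) : ℂ) = e' := by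
      rcases hξ with hξ | hξ
      · exact hξ
      · exfalso
        have hρv : ρ Y = -((Real.exp (v 0) + Real.exp (-(v 0))) / 2) := by
          show (Y.1 * Complex.exp (-(θf Y : ℂ) * I)).re / 2 = _
          rw [hinv, hξ]
          show ((((Real.exp (v 0) + Real.exp (-(v 0)) : ℝ) : ℂ) * e') * (-e')⁻¹).re / 2 = _
          rw [inv_neg, mul_neg, mul_assoc, mul_inv_cancel₀ he'0, mul_one, Complex.neg_re, Complex.ofReal_re, neg_div]
        linarith
    have hρv : ρ Y = Real.cosh (v 0) := by
      show (Y.1 * Complex.exp (-(θf Y : ℂ) * I)).re / 2 = _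
      rw [hinv, hξe]
      show ((((Real.exp (v 0) + Real.exp (-(v 0)) : ℝ) : ℂ) * e') * e'⁻¹).re / 2 = _
      rw [mul_assoc, mul_inv_cancel₀ he'0, mul_one, Complex.ofReal_re, Real.cosh_eq]
    have hρ1 : 1 ≤ ρ Y := hρY.le
    have hcosh : Real.cosh (xf Y) = Real.cosh (v 0) := by
      show Real.cosh (if 0 ≤ v₀ 0 then Real.arcosh (ρ Y) else -Real.arcosh (ρ Y)) = _
      split_ifs
      · rw [Real.cosh_arcosh hρ1, hρv]
      · rw [Real.cosh_neg, Real.cosh_arcosh hρ1, hρv]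
    have hsum : Real.exp (xf Y) + Real.exp (-(xf Y)) = Real.exp (v 0) + Real.exp (-(v 0)) := by
      have h1 := Real.cosh_eq (xf Y)
      have h2 := Real.cosh_eq (v 0)
      rw [hcosh] at h1
      linarith
    have hτ0 : τ Y 0 = xf Y := rfl
    have hτ2 : τ Y 2 = θf Y := rfl
    have hτ1 : (Circle.exp (τ Y 1) : ℂ) = f₁ := by
      show (Circle.exp (v₀ 1 + (Complex.log (Y.2.2 * e₁⁻¹)).im) : ℂ) = f₁
      exact coe_circleExp_add_log_im (Circle.norm_coe _)
    refine ⟨?_, ?_⟩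
    · rw [hτ0, hτ2, hτ1, hsum, hξe]
    · rw [hτ0]
      show (if 0 ≤ v₀ 0 then Real.arcosh (ρ Y) else -Real.arcosh (ρ Y)) ≠ 0
      have hp : 0 < Real.arcosh (ρ Y) := Real.arcosh_pos hρY
      split_ifs
      · exact hp.ne'
      · exact neg_ne_zero.2 hp.ne'

end Literature.NumberTheory.Rogawski1990

end
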